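import Summits.CriticalPhenomena.PercolationContinuityZ3.Theorems.PercNearOneGluingNoHeavyPcintNawChainMemRecords
import HarnessLib

/-!
# PCINT lane, reduction B2c on the dangerous-set automaton — domination `θ^site(p) ≤ p · total n ∅`

Cell `prim-pcint` (PAPER-2 track (iii)), seat `prim-pcint-1` (gen 5); support file (`--supports stmt-CriticalPhenomena-4575`).
Does NOT build on p205010.  Memo: run/shared/lean/prim/pcint/REDUCTIONS.md §B2c (prim-pcint-2 gen 3), §B2c.7 (reduced states).

Counting (`payments_le`: payments of a world ≤ incidences of its forced sites), accounting (`pow_card_forcedSites_le_pow_inc`: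
`(1-p)^{#forced} ≤ q^{Σ incidences}` for `q^{2d} ≥ 1-p`), per-world domination (`pow_forced_le_prod_ofac`), averaging over the
orders (`sum_orders_prod_ofac`), and the main estimate `siteTheta_le_chainMem_total : θ^site(p) ≤ p · (chainMemAut τ kc p q).total n ∅`
(via `siteTheta_le_sum_nawRandEvent` of `…PcintNawRandForcing/Counting`).
-/

noncomputable section

namespace Summit.CriticalPhenomena.PercolationContinuityZ3.Theorems.Pcint

open Finset Literature.Probability.Percolation Literature.Probability.LatticeModels
open Literature.Probability.FitznerVanDerHofstad2017 (wordPos_wordInit)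

variable {{d : ℕ}}

/-! ### Counting the payments of one world and the domination `θ^site(p) ≤ p · total` -/

section Assembly

open Classical

variable (a₀ : Fin d × Bool) {τ kc n : ℕ} {γ : Fin n → Fin d × Bool}

/-- The payments of the included letters are the slots: `#included + #included-with-bonus`. [folklore] -/
theorem sum_cpay_cinc (o : Orders d n) (t : ℕ) (ht : t < n) :
    ∑ b ∈ cinc a₀ τ kc γ o t ht, cpay τ kc (danger τ (pre a₀ γ t)) (γ ⟨t, ht⟩) b =
      (cinc a₀ τ kc γ o t ht).card +
        ((cinc a₀ τ kc γ o t ht).filter fun b => cbonus τ kc (danger τ (pre a₀ γ t)) (γ ⟨t, ht⟩) b = true).card := by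
  rw [card_eq_sum_ones, card_eq_sum_ones, sum_filter, ← sum_add_distrib]
  refine sum_congr rfl fun b hb => ?_
  have hact := (mem_filter.1 hb).2.1
  unfold cpay
  rw [if_pos hact]
  split_ifs <;> rfl

/-- `cu + [bad]·cc` is the payment of the included letters. [folklore] -/
theorem cu_add_cc_eq (o : Orders d n) (t : ℕ) (ht : t < n) :
    cu τ kc (danger τ (pre a₀ γ t)) (γ ⟨t, ht⟩) +
        (if IsBad o γ (t - 1) then cc τ kc (danger τ (pre a₀ γ t)) (γ ⟨t, ht⟩) else 0) =
      ∑ b ∈ cinc a₀ τ kc γ o t ht, cpay τ kc (danger τ (pre a₀ γ t)) (γ ⟨t, ht⟩) b := by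
  unfold cu cc
  rw [cinc, sum_filter]
  by_cases hbad : IsBad o γ (t - 1)
  · rw [if_pos hbad, ← sum_add_distrib]
    refine sum_congr rfl fun b _ => ?_
    unfold cpay
    cases h1 : cactive kc (danger τ (pre a₀ γ t)) (γ ⟨t, ht⟩) b <;>
      cases h2 : cuncond (danger τ (pre a₀ γ t)) (γ ⟨t, ht⟩) b <;>
        cases h3 : ccorner (danger τ (pre a₀ γ t)) b <;> simp [hbad]
  · rw [if_neg hbad, add_zero]
    refine sum_congr rfl fun b _ => ?_
    unfold cpay
    cases h1 : cactive kc (danger τ (pre a₀ γ t)) (γ ⟨t, ht⟩) b <;>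
      cases h2 : cuncond (danger τ (pre a₀ γ t)) (γ ⟨t, ht⟩) b <;> simp [hbad]

/-- The number of slots is the total payment. [folklore] -/
theorem card_cslots_eq (o : Orders d n) :
    (cslots a₀ τ kc γ o).card = ∑ t ∈ (range n).attach,
      ∑ b ∈ cinc a₀ τ kc γ o t.1 (mem_range.1 t.2), cpay τ kc (danger τ (pre a₀ γ t.1)) (γ ⟨t.1, mem_range.1 t.2⟩) b := by
  rw [cslots, card_biUnion]
  · refine sum_congr rfl fun t _ => ?_
    rw [card_union_of_disjoint, card_image_of_injective _ (fun b b' h => by simpa using h),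
      card_image_of_injective _ (fun b b' h => by simpa using h), sum_cpay_cinc]
    rw [Finset.disjoint_left]
    rintro x hx hx'
    obtain ⟨b, -, rfl⟩ := mem_image.1 hx
    obtain ⟨b', -, h⟩ := mem_image.1 hx'
    simpa using congrArg (fun y => y.2.1) h
  · intro t _ t' _ htt
    simp only [Function.onFun]
    rw [Finset.disjoint_left]
    rintro x hx hx'
    have h1 : x.1 = t.1 := by
      rcases mem_union.1 hx with h | h <;> { obtain ⟨b, -, rfl⟩ := mem_image.1 h; rfl }
    have h2 : x.1 = t'.1 := by
      rcases mem_union.1 hx' with h | h <;> { obtain ⟨b, -, rfl⟩ := mem_image.1 h; rfl }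
    exact htt (Subtype.ext (h1.symm.trans h2))

/-- **Counting lemma (REDUCTIONS §B2c.3 for the dangerous-set automaton).** Along a neighbour-avoiding word, the units paid in
the world of `o` number at most the incidences of the `o`-forced sites. [folklore] -/
theorem payments_le (hτ : 2 ≤ τ) (hs : IsSAW γ) (hch : chordEdges γ = ∅) (o : Orders d n) :
    ∑ t ∈ (range n).attach, ∑ b ∈ cinc a₀ τ kc γ o t.1 (mem_range.1 t.2),
        cpay τ kc (danger τ (pre a₀ γ t.1)) (γ ⟨t.1, mem_range.1 t.2⟩) b ≤
      ∑ w ∈ forcedSites o γ, (incTimes γ w).card := by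
  rw [← card_cslots_eq, ← card_cincSet]
  exact card_le_card_of_injOn (crec a₀ τ γ) (fun x hx => crec_mem_cincSet a₀ hs hch hx) (crec_injOn a₀ hτ)

/-- **Accounting (REDUCTIONS §B2c.1)**: `r^{#forced} ≤ q^{Σ_w #incTimes}` when `r ≤ q^{2d}`, `0 ≤ q ≤ 1`. [folklore] -/
theorem pow_card_forcedSites_le_pow_inc (hs : IsSAW γ) (o : Orders d n) {r q : ℝ} (hr0 : 0 ≤ r) (hq0 : 0 ≤ q)
    (hq1 : q ≤ 1) (hrq : r ≤ q ^ (2 * d)) :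
    r ^ (forcedSites o γ).card ≤ q ^ (∑ w ∈ forcedSites o γ, (incTimes γ w).card) := by
  calc r ^ (forcedSites o γ).card = ∏ _w ∈ forcedSites o γ, r := (prod_const _).symm
    _ ≤ ∏ w ∈ forcedSites o γ, q ^ (incTimes γ w).card :=
        prod_le_prod (fun _ _ => hr0) fun w _ => hrq.trans (pow_le_pow_of_le_one hq0 hq1 (card_incTimes_le hs w))
    _ = q ^ (∑ w ∈ forcedSites o γ, (incTimes γ w).card) := prod_pow_eq_pow_sum _ _ _

/-- The factor of step `t` in the world of `o`: `q^{cu_t} · (q^{cc_t} if the corner of steps `t-1, t` is bad, else 1)`. [folklore] -/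
def ofac (τ kc : ℕ) (γ : Fin n → Fin d × Bool) (o : Orders d n) (q : ℝ) (t : ℕ) : ℝ :=
  if ht : t < n then
    q ^ cu τ kc (danger τ (pre a₀ γ t)) (γ ⟨t, ht⟩) *
      (if IsBad o γ (t - 1) then q ^ cc τ kc (danger τ (pre a₀ γ t)) (γ ⟨t, ht⟩) else 1)
  else 1

/-- The symmetric factor of step `t`: `cwt`. [folklore] -/
def sfac (τ kc : ℕ) (γ : Fin n → Fin d × Bool) (q : ℝ) (t : ℕ) : ℝ :=
  if ht : t < n then cwt τ kc q (danger τ (pre a₀ γ t)) (γ ⟨t, ht⟩) else 1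

/-- `q^{payments of the world} = Π_t ofac`. [folklore] -/
theorem pow_payments_eq (o : Orders d n) (q : ℝ) :
    q ^ (∑ t ∈ (range n).attach, ∑ b ∈ cinc a₀ τ kc γ o t.1 (mem_range.1 t.2),
        cpay τ kc (danger τ (pre a₀ γ t.1)) (γ ⟨t.1, mem_range.1 t.2⟩) b) = ∏ t ∈ range n, ofac a₀ τ kc γ o q t := by
  rw [← prod_attach (range n), ← prod_pow_eq_pow_sum]
  refine prod_congr rfl fun t _ => ?_
  have ht := mem_range.1 t.2
  rw [ofac, dif_pos ht, ← cu_add_cc_eq a₀ o t.1 ht, pow_add]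
  split_ifs <;> simp

/-- **Domination in each world**: `(1-p)^{#forcedSites o γ} ≤ Π_t ofac` for a neighbour-avoiding word. [folklore] -/
theorem pow_forced_le_prod_ofac (hτ : 2 ≤ τ) (hs : IsSAW γ) (hch : chordEdges γ = ∅) (o : Orders d n) {r q : ℝ}
    (hr0 : 0 ≤ r) (hq0 : 0 ≤ q) (hq1 : q ≤ 1) (hrq : r ≤ q ^ (2 * d)) :
    r ^ (forcedSites o γ).card ≤ ∏ t ∈ range n, ofac a₀ τ kc γ o q t := by
  rw [← pow_payments_eq]
  exact (pow_card_forcedSites_le_pow_inc hs o hr0 hq0 hq1 hrq).trans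
    (pow_le_pow_of_le_one hq0 hq1 (payments_le a₀ hτ hs hch o))

/-- No remembered site, no payment: `cc = 0` on the empty state. [folklore] -/
theorem cc_empty (a : Fin d × Bool) : cc τ kc (∅ : MState d) a = 0 := by
  unfold cc
  refine sum_eq_zero fun b _ => ?_
  have : cactive kc (∅ : MState d) a b = false := by
    rw [Bool.eq_false_iff, ne_eq, cactive_iff]
    rintro ⟨-, q, hq, -⟩
    rw [mem_cvis] at hq
    exact notMem_empty _ hq.1
  unfold cpay; rw [this]; simp

/-- A step with a conditional payment has perpendicular steps `t-1, t` (so its corner coin is fair). [folklore] -/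
theorem letters_ne_of_cc_ne_zero (hs : IsSAW γ) {t : ℕ} (ht : t < n)
    (hcc : cc τ kc (danger τ (pre a₀ γ t)) (γ ⟨t, ht⟩) ≠ 0) :
    ∃ ht1 : 1 ≤ t, γ ⟨t - 1, by omega⟩ ≠ γ ⟨t, ht⟩ := by
  have ht1 : 1 ≤ t := by
    by_contra h0
    have : t = 0 := by omega
    subst this
    apply hcc
    rw [show pre a₀ γ 0 = (fun i : Fin 0 => wordAt a₀ γ i.1) from rfl, danger_zero]
    exact cc_empty _
  refine ⟨ht1, ?_⟩
  obtain ⟨b, -, hb⟩ := Finset.exists_ne_zero_of_sum_ne_zero hcc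
  have hC : ccorner (danger τ (pre a₀ γ t)) b = true := by
    by_contra h; rw [Bool.not_eq_true] at h; simp [h] at hb
  have hA : cactive kc (danger τ (pre a₀ γ t)) (γ ⟨t, ht⟩) b = true := by
    by_contra h; rw [Bool.not_eq_true] at h
    apply hb; unfold cpay; rw [h]; simp
  obtain ⟨-, hax⟩ := nsite_eq_cornerSite a₀ hs ht ht1 hA hC
  exact fun he => hax (congrArg Prod.fst he)

/-- **Averaging over the orders**: `Σ_o Π_t ofac = #Orders · Π_t sfac`. [folklore] -/
theorem sum_orders_prod_ofac (hs : IsSAW γ) (q : ℝ) :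
    ∑ o : Orders d n, ∏ t ∈ range n, ofac a₀ τ kc γ o q t =
      Fintype.card (Orders d n) * ∏ t ∈ range n, sfac a₀ τ kc γ q t := by
  set ccAt : ℕ → ℕ := fun t => if ht : t < n then cc τ kc (danger τ (pre a₀ γ t)) (γ ⟨t, ht⟩) else 0 with hccAt
  set cuAt : ℕ → ℕ := fun t => if ht : t < n then cu τ kc (danger τ (pre a₀ γ t)) (γ ⟨t, ht⟩) else 0 with hcuAt
  have hcc0 : ccAt 0 = 0 := by
    by_cases h0 : 0 < n
    · simp only [hccAt, dif_pos h0]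
      rw [show pre a₀ γ 0 = (fun i : Fin 0 => wordAt a₀ γ i.1) from rfl, danger_zero]
      exact cc_empty _
    · simp only [hccAt, dif_neg h0]
  set CS : Finset (Fin n) := univ.filter fun s : Fin n => s.1 + 2 ≤ n with hCS
  -- world-o product = (powers of cu) · (coins)
  have hofac : ∀ o, ∏ t ∈ range n, ofac a₀ τ kc γ o q t =
      (∏ t ∈ range n, q ^ cuAt t) * ∏ s ∈ CS, (if IsBad o γ s then q ^ ccAt ((s : ℕ) + 1) else 1) := by
    intro o
    have e1 : ∏ t ∈ range n, ofac a₀ τ kc γ o q t =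
        ∏ t ∈ range n, (q ^ cuAt t * (if IsBad o γ (t - 1) then q ^ ccAt t else 1)) := by
      refine prod_congr rfl fun t ht => ?_
      have ht' := mem_range.1 ht
      simp only [ofac, hcuAt, hccAt, dif_pos ht']
    rw [e1, prod_mul_distrib, prod_range_eq_prod_nodes (fun t => if IsBad o γ (t - 1) then q ^ ccAt t else (1 : ℝ))
      (by simp only [hcc0, pow_zero, ite_self])]
    simp only [Nat.add_sub_cancel]
    rfl
  -- symmetric product = (powers of cu) · (averaged coins)
  have hsfac : ∏ t ∈ range n, sfac a₀ τ kc γ q t = (∏ t ∈ range n, q ^ cuAt t) * ∏ s ∈ CS, (1 + q ^ ccAt ((s : ℕ) + 1)) / 2 := by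
    have e1 : ∏ t ∈ range n, sfac a₀ τ kc γ q t =
        ∏ t ∈ range n, (q ^ cuAt t * (if ccAt t = 0 then 1 else (1 + q ^ ccAt t) / 2)) := by
      refine prod_congr rfl fun t ht => ?_
      have ht' := mem_range.1 ht
      simp only [sfac, cwt, hcuAt, hccAt, dif_pos ht']
    rw [e1, prod_mul_distrib, prod_range_eq_prod_nodes (fun t => if ccAt t = 0 then (1 : ℝ) else (1 + q ^ ccAt t) / 2)
      (by simp only [hcc0, if_true])]
    congr 1
    refine prod_congr rfl fun s _ => ?_
    split_ifs with h
    · rw [h, pow_zero]; norm_num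
    · rfl
  have hcoins := sum_orders_prod_coin q γ CS (fun s => ccAt ((s : ℕ) + 1)) (fun s hsC => by
    have h2 := (mem_filter.1 hsC).2
    refine ⟨h2, fun hcc => ?_⟩
    have hlt : (s : ℕ) + 1 < n := by omega
    have hcc' : cc τ kc (danger τ (pre a₀ γ ((s : ℕ) + 1))) (γ ⟨(s : ℕ) + 1, hlt⟩) ≠ 0 := by
      simpa [hccAt, dif_pos hlt] using hcc
    obtain ⟨_, hne⟩ := letters_ne_of_cc_ne_zero a₀ hs hlt hcc'
    simpa using hne)
  simp_rw [hofac]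
  rw [← mul_sum, hcoins, hsfac]
  ring

include a₀ in
/-- **Domination of site percolation by the B2c automaton** (REDUCTIONS §B2c.4 on dangerous-set states):
`θ^site(p) ≤ p · total n ∅` for every `n`, when `q^{2d} ≥ 1 - p`, `0 ≤ q ≤ 1`, `τ ≥ 2`. [folklore] -/
theorem siteTheta_le_chainMem_total (hτ : 2 ≤ τ) (p : unitInterval) {q : ℝ} (hq0 : 0 ≤ q) (hq1 : q ≤ 1)
    (hpq : 1 - (p : ℝ) ≤ q ^ (2 * d)) (n : ℕ) :
    siteTheta (zdGraph d) 0 p ≤ (p : ℝ) * (chainMemAut (d := d) τ kc p q p.2.1 hq0).total n ∅ := by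
  have hp0 : (0 : ℝ) ≤ p := p.2.1
  have hp1' : 0 ≤ 1 - (p : ℝ) := sub_nonneg.2 p.2.2
  set M := chainMemAut (d := d) τ kc p q p.2.1 hq0 with hM
  set NW := (sawWords d n).filter fun w => chordEdges w = ∅ with hNW
  -- per order
  have ho : ∀ o : Orders d n, siteTheta (zdGraph d) 0 p ≤
      ∑ γ ∈ NW, (p : ℝ) ^ (n + 1) * ∏ t ∈ range n, ofac a₀ τ kc γ o q t := by
    intro o
    refine (siteTheta_le_sum_nawRandEvent p o).trans (sum_le_sum fun γ hγ => ?_)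
    obtain ⟨hsaw, hch⟩ := mem_filter.1 hγ
    exact mul_le_mul_of_nonneg_left
      (pow_forced_le_prod_ofac a₀ hτ (mem_sawWords.1 hsaw) hch o hp1' hq0 hq1 hpq) (pow_nonneg hp0 _)
  have hO : (0 : ℝ) < Fintype.card (Orders d n) := Nat.cast_pos.2 Fintype.card_pos
  have hsum := sum_le_sum fun (o : Orders d n) (_ : o ∈ univ) => ho o
  rw [sum_const, card_univ, nsmul_eq_mul, sum_comm] at hsum
  have key : ∑ γ ∈ NW, ∑ o : Orders d n, (p : ℝ) ^ (n + 1) * ∏ t ∈ range n, ofac a₀ τ kc γ o q t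
      = Fintype.card (Orders d n) * ∑ γ ∈ NW, (p : ℝ) ^ (n + 1) * ∏ t ∈ range n, sfac a₀ τ kc γ q t := by
    rw [mul_sum]
    refine sum_congr rfl fun γ hγ => ?_
    rw [← mul_sum, sum_orders_prod_ofac a₀ (mem_sawWords.1 (mem_filter.1 hγ).1)]
    ring
  rw [key] at hsum
  have h1 : siteTheta (zdGraph d) 0 p ≤ ∑ γ ∈ NW, (p : ℝ) ^ (n + 1) * ∏ t ∈ range n, sfac a₀ τ kc γ q t :=
    le_of_mul_le_mul_left hsum hO
  refine h1.trans ?_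
  -- the symmetric product is the run of the automaton
  have hrun : ∀ γ ∈ NW, (p : ℝ) ^ (n + 1) * ∏ t ∈ range n, sfac a₀ τ kc γ q t = (p : ℝ) * M.run n ∅ γ := by
    intro γ hγ
    obtain ⟨hsaw, hch⟩ := mem_filter.1 hγ
    have hs := mem_sawWords.1 hsaw
    have h := M.run_eq_prod_of_states n (fun t => danger τ (pre a₀ γ t)) γ (fun t ht => by
      rw [hM]; exact nstep_danger_pre a₀ hτ hs hch ht)
    have h0 : danger τ (pre a₀ γ 0) = ∅ := danger_zero τ _
    rw [h0] at h
    have hwt : ∀ (t : ℕ) (ht : t < n), M.wt (danger τ (pre a₀ γ t)) (γ ⟨t, ht⟩) =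
        (p : ℝ) * cwt τ kc q (danger τ (pre a₀ γ t)) (γ ⟨t, ht⟩) := fun t ht => by rw [hM]; rfl
    rw [h, pow_succ, mul_comm _ (p : ℝ), mul_assoc]
    congr 1
    rw [show (p : ℝ) ^ n = ∏ _t ∈ range n, (p : ℝ) by rw [prod_const, card_range], ← prod_mul_distrib]
    refine prod_congr rfl fun t ht => ?_
    have ht' := mem_range.1 ht
    rw [dif_pos ht', sfac, dif_pos ht', hwt t ht']
  calc ∑ γ ∈ NW, (p : ℝ) ^ (n + 1) * ∏ t ∈ range n, sfac a₀ τ kc γ q t = ∑ γ ∈ NW, (p : ℝ) * M.run n ∅ γ :=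
        sum_congr rfl hrun
    _ = (p : ℝ) * ∑ γ ∈ NW, M.run n ∅ γ := by rw [mul_sum]
    _ ≤ (p : ℝ) * M.total n ∅ := mul_le_mul_of_nonneg_left (M.sum_run_le_total n ∅ NW) hp0

end Assembly

end Summit.CriticalPhenomena.PercolationContinuityZ3.Theorems.Pcint
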